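import Summits.KontsevichZagierPeriods.KontsevichZagierPeriods.Theorems.LinRedNormalFormArrangementNormalFormSeparateCut

/-!
# Iterated rule (1a): cutting along finitely many rational lines

(Line `janus-bands`, crux `ArrangementNormalForm`, stub `stub_separateTwoZero` — separation in a
good rational direction for PLANAR arrangement representations without fibres; part `Cuts`.)

`cuts_fin` (registered in literal form as `separateTwoZero_cuts`): cutting a planar arrangement
representation (literal `JJ 2 0` data) successively along finitely many non-zero rational lines
(`separatePos_cut`); every piece is literal data with the same integrand whose rows contain the
old rows and every cutting form up to sign, and `[s] ≡ ∑ [pieces]` modulo `KZ.relations`.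
-/

noncomputable section

open Set MeasureTheory Filter Topology
open scoped ENNReal

namespace Summit.KontsevichZagierPeriods.ArrangementNormalForm.JanusBands

open Literature.NumberTheory.Transcendental

namespace SepTwoZero

/-- **Iterated rule (1a)**: cutting a planar arrangement representation (literal `JJ 2 0` data)
successively along finitely many non-zero rational lines. Every resulting piece is again
literal data with the same integrand, its rows contain the old rows and each cutting form up
to sign, and `[s] ≡ ∑ [pieces]`. -/
theorem cuts_fin (m : ℕ) (L : Fin m → (Fin (1 + 1) → ℚ) × ℚ) (e : Fin m → ℕ)
    (p : MvPolynomial (Fin (1 + 1)) ℚ) (a : Fin 0 → Option ((Fin (1 + 1) → ℚ) × ℚ))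
    (lo hi : Fin 0 → Fin 0 ⊕ ((Fin (1 + 1) → ℚ) × ℚ)) (T : ℕ) :
    ∀ (hs : Fin T → (Fin (1 + 1) → ℚ) × ℚ), (∀ t, hs t ≠ 0) →
    ∀ (m' : ℕ) (M : Fin m' → (Fin (1 + 1) → ℚ) × ℚ) (s : KZ.IntegralRep (1 + 1 + 0)),
      Bornology.IsBounded s.domain →
      s.domain = {z | (∀ j, 0 < ∑ i, ((M j).1 i : ℝ) * z (Fin.castAdd 0 i) + ((M j).2 : ℝ)) ∧
        ∀ i, Sum.elim (fun j => z (Fin.natAdd (1 + 1) j)) (fun c => ∑ i', (c.1 i' : ℝ) *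
          z (Fin.castAdd 0 i') + (c.2 : ℝ)) (lo i) < z (Fin.natAdd (1 + 1) i) ∧
          z (Fin.natAdd (1 + 1) i) < Sum.elim (fun j => z (Fin.natAdd (1 + 1) j))
          (fun c => ∑ i', (c.1 i' : ℝ) * z (Fin.castAdd 0 i') + (c.2 : ℝ)) (hi i)} →
      EqOn s.integrand (fun z => MvPolynomial.aeval (fun i => z (Fin.castAdd 0 i)) p /
        (∏ j, (∑ i, ((L j).1 i : ℝ) * z (Fin.castAdd 0 i) + ((L j).2 : ℝ)) ^ e j) *
        ∏ i, (a i).elim 1 (fun c => 1 / (z (Fin.natAdd (1 + 1) i) -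
          (∑ i', (c.1 i' : ℝ) * z (Fin.castAdd 0 i') + (c.2 : ℝ))))) s.domain →
      ∃ c ∈ AddSubgroup.closure {w : KZ.FormalRep | ∃ (m₁ : ℕ)
        (M₁ : Fin m₁ → (Fin (1 + 1) → ℚ) × ℚ) (s₁ : KZ.IntegralRep (1 + 1 + 0)),
        (∀ j, ∃ j₁, M₁ j₁ = M j) ∧ (∀ t, ∃ j₁, ∃ ε : ℚ, (ε = 1 ∨ ε = -1) ∧ M₁ j₁ = ε • hs t) ∧
        Bornology.IsBounded s₁.domain ∧
        s₁.domain = {z | (∀ j, 0 < ∑ i, ((M₁ j).1 i : ℝ) * z (Fin.castAdd 0 i) + ((M₁ j).2 : ℝ)) ∧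
          ∀ i, Sum.elim (fun j => z (Fin.natAdd (1 + 1) j)) (fun c => ∑ i', (c.1 i' : ℝ) *
            z (Fin.castAdd 0 i') + (c.2 : ℝ)) (lo i) < z (Fin.natAdd (1 + 1) i) ∧
            z (Fin.natAdd (1 + 1) i) < Sum.elim (fun j => z (Fin.natAdd (1 + 1) j))
            (fun c => ∑ i', (c.1 i' : ℝ) * z (Fin.castAdd 0 i') + (c.2 : ℝ)) (hi i)} ∧
        EqOn s₁.integrand (fun z => MvPolynomial.aeval (fun i => z (Fin.castAdd 0 i)) p /
          (∏ j, (∑ i, ((L j).1 i : ℝ) * z (Fin.castAdd 0 i) + ((L j).2 : ℝ)) ^ e j) *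
          ∏ i, (a i).elim 1 (fun c => 1 / (z (Fin.natAdd (1 + 1) i) -
            (∑ i', (c.1 i' : ℝ) * z (Fin.castAdd 0 i') + (c.2 : ℝ))))) s₁.domain ∧
        w = KZ.of s₁}, KZ.of s - c ∈ KZ.relations := by
  induction T with
  | zero =>
    intro hs _ m' M s hbd hdom hint
    exact ⟨KZ.of s, AddSubgroup.subset_closure ⟨m', M, s, fun j => ⟨j, rfl⟩,
      fun t => t.elim0, hbd, hdom, hint, rfl⟩, by simp⟩
  | succ T ih =>
    intro hs hne m' M s hbd hdom hint
    obtain ⟨M₁, M₂, s₁, s₂, hM₁, hM₂, -, -, -, -, hbd₁, hdom₁, hint₁, hbd₂, hdom₂, hint₂, hrel⟩ :=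
      separatePos_cut (1 + 1) 0 m m' s M L e p a lo hi hbd hdom hint (hs 0) (hne 0)
    have hne' : ∀ t : Fin T, hs t.succ ≠ 0 := fun t => hne _
    obtain ⟨c₁, hc₁, hr₁⟩ := ih (fun t => hs t.succ) hne' (m' + 1) M₁ s₁ hbd₁ hdom₁ hint₁
    obtain ⟨c₂, hc₂, hr₂⟩ := ih (fun t => hs t.succ) hne' (m' + 1) M₂ s₂ hbd₂ hdom₂ hint₂
    -- the pieces of the children are pieces of the parent
    have hsub : ∀ (Mc : Fin (m' + 1) → (Fin (1 + 1) → ℚ) × ℚ) (ε₀ : ℚ), (ε₀ = 1 ∨ ε₀ = -1) →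
        Mc = Fin.snoc M (ε₀ • hs 0) →
        {w : KZ.FormalRep | ∃ (m₁ : ℕ) (M₁ : Fin m₁ → (Fin (1 + 1) → ℚ) × ℚ)
          (s₁ : KZ.IntegralRep (1 + 1 + 0)),
          (∀ j, ∃ j₁, M₁ j₁ = Mc j) ∧
          (∀ t : Fin T, ∃ j₁, ∃ ε : ℚ, (ε = 1 ∨ ε = -1) ∧ M₁ j₁ = ε • hs t.succ) ∧
          Bornology.IsBounded s₁.domain ∧
          s₁.domain = {z | (∀ j, 0 < ∑ i, ((M₁ j).1 i : ℝ) * z (Fin.castAdd 0 i) +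
            ((M₁ j).2 : ℝ)) ∧ ∀ i, Sum.elim (fun j => z (Fin.natAdd (1 + 1) j))
            (fun c => ∑ i', (c.1 i' : ℝ) * z (Fin.castAdd 0 i') + (c.2 : ℝ)) (lo i) <
            z (Fin.natAdd (1 + 1) i) ∧ z (Fin.natAdd (1 + 1) i) <
            Sum.elim (fun j => z (Fin.natAdd (1 + 1) j)) (fun c => ∑ i', (c.1 i' : ℝ) *
            z (Fin.castAdd 0 i') + (c.2 : ℝ)) (hi i)} ∧
          EqOn s₁.integrand (fun z => MvPolynomial.aeval (fun i => z (Fin.castAdd 0 i)) p /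
            (∏ j, (∑ i, ((L j).1 i : ℝ) * z (Fin.castAdd 0 i) + ((L j).2 : ℝ)) ^ e j) *
            ∏ i, (a i).elim 1 (fun c => 1 / (z (Fin.natAdd (1 + 1) i) -
              (∑ i', (c.1 i' : ℝ) * z (Fin.castAdd 0 i') + (c.2 : ℝ))))) s₁.domain ∧
          w = KZ.of s₁} ⊆
        {w : KZ.FormalRep | ∃ (m₁ : ℕ) (M₁ : Fin m₁ → (Fin (1 + 1) → ℚ) × ℚ)
          (s₁ : KZ.IntegralRep (1 + 1 + 0)),
          (∀ j, ∃ j₁, M₁ j₁ = M j) ∧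
          (∀ t : Fin (T + 1), ∃ j₁, ∃ ε : ℚ, (ε = 1 ∨ ε = -1) ∧ M₁ j₁ = ε • hs t) ∧
          Bornology.IsBounded s₁.domain ∧
          s₁.domain = {z | (∀ j, 0 < ∑ i, ((M₁ j).1 i : ℝ) * z (Fin.castAdd 0 i) +
            ((M₁ j).2 : ℝ)) ∧ ∀ i, Sum.elim (fun j => z (Fin.natAdd (1 + 1) j))
            (fun c => ∑ i', (c.1 i' : ℝ) * z (Fin.castAdd 0 i') + (c.2 : ℝ)) (lo i) <
            z (Fin.natAdd (1 + 1) i) ∧ z (Fin.natAdd (1 + 1) i) <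
            Sum.elim (fun j => z (Fin.natAdd (1 + 1) j)) (fun c => ∑ i', (c.1 i' : ℝ) *
            z (Fin.castAdd 0 i') + (c.2 : ℝ)) (hi i)} ∧
          EqOn s₁.integrand (fun z => MvPolynomial.aeval (fun i => z (Fin.castAdd 0 i)) p /
            (∏ j, (∑ i, ((L j).1 i : ℝ) * z (Fin.castAdd 0 i) + ((L j).2 : ℝ)) ^ e j) *
            ∏ i, (a i).elim 1 (fun c => 1 / (z (Fin.natAdd (1 + 1) i) -
              (∑ i', (c.1 i' : ℝ) * z (Fin.castAdd 0 i') + (c.2 : ℝ))))) s₁.domain ∧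
          w = KZ.of s₁} := by
      rintro Mc ε₀ hε₀ hMc w ⟨m₁, M₁', s₁', hold, hnew, hb, hd, hi', rfl⟩
      refine ⟨m₁, M₁', s₁', fun j => ?_, fun t => ?_, hb, hd, hi', rfl⟩
      · obtain ⟨j₁, hj₁⟩ := hold (Fin.castSucc j)
        exact ⟨j₁, by rw [hj₁, hMc, Fin.snoc_castSucc]⟩
      · refine Fin.cases ?_ (fun t => hnew t) t
        obtain ⟨j₁, hj₁⟩ := hold (Fin.last m')
        exact ⟨j₁, ε₀, hε₀, by rw [hj₁, hMc, Fin.snoc_last]⟩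
    have h1 := AddSubgroup.closure_mono (hsub M₁ 1 (Or.inl rfl) (by rw [hM₁, one_smul])) hc₁
    have h2 := AddSubgroup.closure_mono (hsub M₂ (-1) (Or.inr rfl) (by rw [hM₂, neg_one_smul])) hc₂
    refine ⟨c₁ + c₂, add_mem h1 h2, ?_⟩
    have : KZ.of s - (c₁ + c₂) = (KZ.of s - KZ.of s₁ - KZ.of s₂) + (KZ.of s₁ - c₁) +
        (KZ.of s₂ - c₂) := by abel
    rw [this]
    exact add_mem (add_mem hrel hr₁) hr₂

end SepTwoZero

open SepTwoZero in
/-- **Iterated rule (1a)** (registered sub-goal of `stub_separateTwoZero`; literal form of `SepTwoZero.cuts_fin`). -/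
theorem separateTwoZero_cuts (m : ℕ) (L : Fin m → (Fin (1 + 1) → ℚ) × ℚ) (e : Fin m → ℕ) (p : MvPolynomial (Fin (1 + 1)) ℚ) (a : Fin 0 → Option ((Fin (1 + 1) → ℚ) × ℚ)) (lo hi : Fin 0 → Fin 0 ⊕ ((Fin (1 + 1) → ℚ) × ℚ)) (T : ℕ) : ∀ (hs : Fin T → (Fin (1 + 1) → ℚ) × ℚ), (∀ t, hs t ≠ 0) → ∀ (m' : ℕ) (M : Fin m' → (Fin (1 + 1) → ℚ) × ℚ) (s : KZ.IntegralRep (1 + 1 + 0)), Bornology.IsBounded s.domain → s.domain = {z | (∀ j, 0 < ∑ i, ((M j).1 i : ℝ) * z (Fin.castAdd 0 i) + ((M j).2 : ℝ)) ∧ ∀ i, Sum.elim (fun j => z (Fin.natAdd (1 + 1) j)) (fun c => ∑ i', (c.1 i' : ℝ) * z (Fin.castAdd 0 i') + (c.2 : ℝ)) (lo i) < z (Fin.natAdd (1 + 1) i) ∧ z (Fin.natAdd (1 + 1) i) < Sum.elim (fun j => z (Fin.natAdd (1 + 1) j)) (fun c => ∑ i', (c.1 i' : ℝ) * z (Fin.castAdd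 0 i') + (c.2 : ℝ)) (hi i)} → EqOn s.integrand (fun z => MvPolynomial.aeval (fun i => z (Fin.castAdd 0 i)) p / (∏ j, (∑ i, ((L j).1 i : ℝ) * z (Fin.castAdd 0 i) + ((L j).2 : ℝ)) ^ e j) * ∏ i, (a i).elim 1 (fun c => 1 / (z (Fin.natAdd (1 + 1) i) - (∑ i', (c.1 i' : ℝ) * z (Fin.castAdd 0 i') + (c.2 : ℝ))))) s.domain → ∃ c ∈ AddSubgroup.closure {w : KZ.FormalRep | ∃ (m₁ : ℕ) (M₁ : Fin m₁ → (Fin (1 + 1) → ℚ) × ℚ) (s₁ : KZ.IntegralRep (1 + 1 + 0)), (∀ j, ∃ j₁, M₁ j₁ = M j) ∧ (∀ t, ∃ j₁, ∃ ε : ℚ, (ε = 1 ∨ ε = -1) ∧ M₁ j₁ = ε • hs t) ∧ Bornology.IsBounded s₁.domain ∧ s₁.domain = {z | (∀ j, 0 < ∑ i, ((M₁ j).1 i : ℝ) * z (Fin.castAdd 0 i) + ((M₁ j).2 : ℝ)) ∧ ∀ i, Sum.elim (fun j => z (Fin.natAdd (1 + 1) j)) (fun c => ∑ i', (c.1 i'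 : ℝ) * z (Fin.castAdd 0 i') + (c.2 : ℝ)) (lo i) < z (Fin.natAdd (1 + 1) i) ∧ z (Fin.natAdd (1 + 1) i) < Sum.elim (fun j => z (Fin.natAdd (1 + 1) j)) (fun c => ∑ i', (c.1 i' : ℝ) * z (Fin.castAdd 0 i') + (c.2 : ℝ)) (hi i)} ∧ EqOn s₁.integrand (fun z => MvPolynomial.aeval (fun i => z (Fin.castAdd 0 i)) p / (∏ j, (∑ i, ((L j).1 i : ℝ) * z (Fin.castAdd 0 i) + ((L j).2 : ℝ)) ^ e j) * ∏ i, (a i).elim 1 (fun c => 1 / (z (Fin.natAdd (1 + 1) i) - (∑ i', (c.1 i' : ℝ) * z (Fin.castAdd 0 i') + (c.2 : ℝ))))) s₁.domain ∧ w = KZ.of s₁}, KZ.of s - c ∈ KZ.relations := by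
  exact cuts_fin m L e p a lo hi T

end Summit.KontsevichZagierPeriods.ArrangementNormalForm.JanusBands
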